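import Summits.QuantumFields.YangMills.Theorems.BalabanUVNodesN27AtReadingOfRecord13CoPHN16OfThm33
import Summits.QuantumFields.YangMills.Theorems.BalabanUVNodesN15AtReadingOfRecord13CoPHC2Bg
import Summits.QuantumFields.YangMills.Theorems.BalabanUVNodesN14AtRateRecord13CoPHOn

/-!
# BalabanUVNodes ∕ N27 = binder B5 AT THE RECORD — XLIᶜᵒᵖᴴ AT THE ADMISSIBLE `CoPH` READING OF RECORD WITH EVERY K4 RATE SLOT IN ITS PRODUCER's DEEPEST LANDED CURRENCY AT
# ONCE (the ₁₃-`CoPH` analogue of the ₁₂-era module XXXV `…N27AtEpsSmallFieldsGenStrip12` «every produced K4 in-edge of K3′ in the producers' words at one reading»):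
# N14 ⟸ END-B UNIFORM LEAVES on the residual dressed tower (dag-n14-c `YMDAG.N14.s_N14_rRec₁₃CoPHOn_of_uniformLeaves` ∕ dag-n14-a `n14At_of_uniformLeaves`), N15 ⟸ the READING
# EQUATION onto dag-n15-a∕-c's primitive-carrier family with the U-seeing unit layer (U-E `s_N15_readingOfRecord₁₃CoPH(On)_of_c2Bg_family`), N16 ⟸ node N06's
# [Balaban1985BackgroundPropagators] THEOREM 3.3 + member-local dictionary + [4] Thm 3.1-type letters + N07's linear leaf, LETTERS CHOSEN (dag-n16-e 40ᴮ via (L)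
# `…N27AtReadingOfRecord13CoPHN16OfThm33`), N17 ELIMINATED (dag-n17-a), N18 in CLOSED FORM on node00-def-W1's admissible tables (§2) ∕ unfolded stub form (§1), N22 ⟸ N18 by
# dag-n22-e 8a″ (analytic ∕ STRIP letter currencies), (D4) read-out displayed; the K5 side (N20, N21, N27x ∕ `hx`, the N19′ edge ∀ ℓ₃) displayed as in every storey
# (cell `pub-ymgap`, HUMAN RULING D-0062 Track A, R134 seat `pub-ymgap-dag-n27-c` (s2) gen 10; K3⁷ `SpineGivenEndpointR13SepCoPH` = stmt-QuantumFields-20544, `--kind proof --supports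
# 20544 --as helper`; COUNT-NEUTRAL; THEOREMS ONLY, 0 `def`, 0 `sorry`; `N`-generic, regime-generic, NO Theses import — the item-facing face is leaf C
# `…N27SpineGivenEndpointR13SepCoPHProducers` (ONE application of leaf A §4 at `Rg := the item's guard`, `N = 2`))

WHAT IS KERNEL-CHECKED ([bookkeeping]; each theorem = (L) §2's theorem of the same home with its `h14` slot fed by dag-n14-c∕-a's uniform-leaves face and its `h15` slot
fed by U-E's reading-equation face; §0's N16 inputs `{g₃} (hg₃) (hD) (h7)` are 40ᴮ's binders VERBATIM as section variables, exactly as in (L)):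
* §1 `spine_rec13CCoPH_at_readingAdm₁₃CoPH_of_uniformLeaves_c2Bg_thm33Letters` — CANONICAL HOME (datum-keyed slots at `h.params`): N14 ⟸ `∃ U : UniformConstants, U.Λ = (ne1 …).Λ ∧
  ∀ p K, Nonempty (BookingLeaves U …)` per keyed datum; N15 ⟸ `hne2`; N16 ⟸ §0; N18 unfolded; N22 ⟸ N18 (analytic currency, (J), (A), eleven numerals VERBATIM); (D4); spine side.
* §2 `spine_rec13CCoPHOn_at_readingAdm₁₃CoPH_of_uniformLeaves_c2Bg_thm33Letters` — REGIME HOME, any `Rg` (guarded θ-form slots): the same with N18 in closed form at θ and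
  N22 ⟸ N18 in the STRIP currency; at `Rg := Node00.unityNondeg₁₃H N` RR-2's CN class; at `N = 2`, `Rg :=` the item's guard, THE ITEM (leaf C).

HONEST FRAMING.  COMPOSITE-node bookkeeping BY NAME; no estimate.  EVERY displayed antecedent is a HYPOTHESIS inhabited for no family today: END-B uniform leaves on the residual
dressed tower `ne1` (NE1′ NOT PRINTED — [Balaban1989LargeFieldII] (1.73)–(1.75) type the action only — and NOT PROVED; the dressed tower OF RECORD is NODE O's), the reading
equation `hne2` onto a MODEL-level family (NOT [B9] Thm 3.15 at general `U`), Thm 3.3 ∕ dictionary ∕ letters ∕ `LeafH3sup` (nodes N05∕N06∕N07), node00-def-W1's table letters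
and numerals, the N18 closed-form bound, the (D4) read-out, the K5 stubs and the N19′ edge; nothing of Bałaban's asserted or instantiated; no `Provisos₁₃CoPH` inhabitant
claimed (K0⁷ open); N14 ∕ N15 ∕ N16 ∕ N18 ∕ N22 ∕ N27 NOT discharged; K3⁷ NOT claimed; counts UNMOVED (typed 28∕28 · discharged 5∕27, A 5∕28); one finite four-torus programme
at fixed `ε` — NOT ℝ⁴, NOT infinite volume, NOT OS, NOT a mass gap, NOT Clay.  No decl below carries a cite tag.
-/

set_option autoImplicit false

namespace Summit.QuantumFields.YangMills.Theorems.BalabanUVNodesN27SpineRecord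

open Set Metric
open scoped Matrix.Norms.L2Operator

open Literature.MathematicalPhysics.QuantumFieldTheory.Balaban1983to89
open Literature.MathematicalPhysics.QuantumFieldTheory.Balaban1983to89.T4Continuum
open Literature.MathematicalPhysics.QuantumFieldTheory.Balaban1983to89.T4OutputRate (Carriers Functional NE5 DecayBound Window)
open Literature.MathematicalPhysics.QuantumFieldTheory.Balaban1983to89.TreeLengthTorus (TDom tsys torusTreeLen)
open Literature.MathematicalPhysics.QuantumFieldTheory.Balaban1983to89.T4InputCauchyRateData (StepModel)
open Literature.MathematicalPhysics.QuantumFieldTheory.Balaban1983to89.B13Resummation (locE)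
open Literature.MathematicalPhysics.QuantumFieldTheory.Balaban1983to89.TreeLengthTorusGeometry (TTouch)
open Literature.MathematicalPhysics.QuantumFieldTheory.Balaban1983to89.B12TreeDecay (K₀)
open Summit.QuantumFields.BalabanUV.T4Continuum.Spine.NE5
open YMDAG.N18.HLayer
open YMDAG.N18.W1Reading (s_N18_rRec₁₃CoPH_readingAdm_of_envelope_bound238_pin n18At_u3OfRecord₁₃_readingAdm_iff)
open T4ContinuumYM4Torus (ForSmallCouplings)
open Summit.QuantumFields.BalabanUV.T4Continuum.Spine
open YMDAG.UVSplit
open Node00 (Stage13HParams datumOfRecord₁₃CoPH IsRecordOfRecord₁₃CCoPH IsDatumOfRecord₁₃CCoPH NE3Letters₁₁ NE2Objects₁₁ ne3ConstLayerOfRecord₁₁ MatA ιSU prependCoupling)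
open Node00.Sect2 (domCount domSys CPair ofBackgroundC)
open Node00.W1 (ReadingData LevelPairing LetterInputs ClusterTower pairOfRecord functionalC termC box SpRestr AdmBg)
open YMDAG.N22 (s_N22_readingOfRecord₁₃CoPH_ofRecordAdm_of_s_N18_analytic s_N22_readingOfRecord₁₃CoPHOn_ofRecordAdm_of_s_N18_stripBound)
open B7Prop1Explicit B7Prop2Explicit
open B8Ineq132 (InAk covDerivFwd)
open B8LeafModelZd (ZdIdx)
open B8SockLettersRD (SockLettersRD)
open B7Eq78Linearization (zdBlocking QprimeIter)
open B8Eq119TwistedAxial (bgT)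
open B8Eq140Level (SideTouches)
open B8Eq138LandauZd (covLap QT)
open B8Eq1117Concrete (XSpace)
open B8Prop5ContractionKLevel (Bd2)
open B8LambdaSpaceKLevel (wt)
open B9SupplySockB9P3ZdLetters (OpsZd)
open B9SupplySockB9P3ZdAt (DictAt Prop6At InvAt CurvAt LandauAt AvgAt HolderAt)
open Node00 (ne3NperOfRecord₁₁ ne3DomOfRecord₁₁)
open Summit.QuantumFields.BalabanUV.T4Continuum.NE3.LeafIndexSockets (LeafH3sup)
open Summit.QuantumFields.YangMills.BalabanUVNodes.N16OfThm33LettersAllTorusAtRecord13CoPH (exists_letters_s_N16_readingOfRecord₁₃CoPHOn_of_thm33Letters_allTorus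
  exists_letters_s_N16_readingOfRecord₁₃CoPH_of_thm33Letters_allTorus)
open Summit.QuantumFields.BalabanUV.T4Continuum.NE1p.DressedRoot (UniformConstants BookingLeaves)
open YMDAG.N14 (n14At_of_uniformLeaves s_N14_rRec₁₃CoPHOn_of_uniformLeaves)
open Summit.QuantumFields.YangMills.BalabanUVNodes.N15.AtKeyedHome (neZero_blockFactor)
open Summit.QuantumFields.YangMills.BalabanUVNodes.N15.UnitLayerBg (c2BgObjects)
open Summit.QuantumFields.YangMills.BalabanUVNodes.N15.AtReadingOfRecord13CoPH (s_N15_readingOfRecord₁₃CoPH_of_c2Bg_family s_N15_readingOfRecord₁₃CoPHOn_of_c2Bg_family)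

variable {N : ℕ} [NeZero N] (cr : SpineReading₁₃CoPH N)

/-! ## §0 The N16 supplier's inputs (dag-n16-e 40ᴮ, VERBATIM; as in (L)) -/

variable {g₃ : T4Family → ℝ} (hg₃ : ∀ F, 0 < g₃ F)
  (hD : ∀ F : T4Family, letI : CStarAlgebra (Matrix (Fin N) (Fin N) ℂ) := {}
      ∃ (len : Site 4 → ℝ) (I : Type) (geo : I → B9.Geometry) (bg : I → B9.Backgrounds) (GA Gp : ∀ i, B9.KernelFamily (geo i) (bg i)) (c35 : ℝ)
        (mem : ℝ → ZdIdx 4 F.L → ℕ → I)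
        (ιCfg : ∀ (M : ℝ) (i : ZdIdx 4 F.L) (m : ℕ) (U₀ : Site 4 → Fin 4 → (Matrix (Fin N) (Fin N) ℂ)ˣ), (∀ x κ, U₀ x κ ∈ unitaryUnits (Matrix (Fin N) (Fin N) ℂ)) → (bg (mem M i m)).Cfg)
        (ιLoc : ∀ (M : ℝ) (i : ZdIdx 4 F.L) (m : ℕ), (Site 4 → Fin 4 → Matrix (Fin N) (Fin N) ℂ) → (geo (mem M i m)).Loc)
        (ops : ℝ → ZdIdx 4 F.L → ℕ → OpsZd 4 (Matrix (Fin N) (Fin N) ℂ)) (c₆ K₆ M₃ a₃ c69 q CH B₀'H B₂' BG BR cL : ℝ),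
        (∀ v : Site 4, 0 < len v → 1 ≤ len v) ∧ (∀ μ : Fin 4, len (e μ) = 1) ∧
        B9.Thm33Printed c35 geo bg Gp GA ∧
        0 < c₆ ∧ 0 < K₆ ∧ 0 < a₃ ∧ 0 ≤ c69 ∧ 0 ≤ q ∧ 0 < B₀'H ∧ 0 ≤ B₂' ∧ 0 ≤ BG ∧ 0 ≤ BR ∧ 0 < cL ∧
        (∀ (M : ℝ) (i : {i : ZdIdx 4 F.L // (∀ j, i.Ω j = Set.univ) ∧ (∀ m j, i.Λs m j = {_y | j = m}) ∧ (∀ m j, i.Λb m j = {_c | j = m}) ∧ i.η = ((F.L : ℝ)⁻¹) ^ i.k}) (m : ℕ), DictAt geo bg GA F.L mem ιCfg ιLoc ops M i.1 m) ∧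
        (∀ (M : ℝ) (i : {i : ZdIdx 4 F.L // (∀ j, i.Ω j = Set.univ) ∧ (∀ m j, i.Λs m j = {_y | j = m}) ∧ (∀ m j, i.Λb m j = {_c | j = m}) ∧ i.η = ((F.L : ℝ)⁻¹) ^ i.k}) (m : ℕ), M₃ ≤ M → Prop6At bg F.L mem ιCfg c35 c₆ K₆ M i.1 m) ∧
        (∀ (M : ℝ) (i : {i : ZdIdx 4 F.L // (∀ j, i.Ω j = Set.univ) ∧ (∀ m j, i.Λs m j = {_y | j = m}) ∧ (∀ m j, i.Λb m j = {_c | j = m}) ∧ i.η = ((F.L : ℝ)⁻¹) ^ i.k}) (m : ℕ), M₃ ≤ M → InvAt bg F.L mem ιCfg ops c35 a₃ M i.1 m) ∧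
        (∀ (M : ℝ) (i : {i : ZdIdx 4 F.L // (∀ j, i.Ω j = Set.univ) ∧ (∀ m j, i.Λs m j = {_y | j = m}) ∧ (∀ m j, i.Λb m j = {_c | j = m}) ∧ i.η = ((F.L : ℝ)⁻¹) ^ i.k}) (m : ℕ), M₃ ≤ M → CurvAt bg F.L mem ιCfg ops c35 a₃ c69 M i.1 m) ∧
        (∀ (M : ℝ) (i : {i : ZdIdx 4 F.L // (∀ j, i.Ω j = Set.univ) ∧ (∀ m j, i.Λs m j = {_y | j = m}) ∧ (∀ m j, i.Λb m j = {_c | j = m}) ∧ i.η = ((F.L : ℝ)⁻¹) ^ i.k}) (m : ℕ), M₃ ≤ M → LandauAt bg F.L mem ιCfg ops c35 a₃ M i.1 m) ∧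
        (∀ (M : ℝ) (i : {i : ZdIdx 4 F.L // (∀ j, i.Ω j = Set.univ) ∧ (∀ m j, i.Λs m j = {_y | j = m}) ∧ (∀ m j, i.Λb m j = {_c | j = m}) ∧ i.η = ((F.L : ℝ)⁻¹) ^ i.k}) (m : ℕ), AvgAt F.L ops q M i.1 m) ∧
        (∀ (M : ℝ) (i : {i : ZdIdx 4 F.L // (∀ j, i.Ω j = Set.univ) ∧ (∀ m j, i.Λs m j = {_y | j = m}) ∧ (∀ m j, i.Λb m j = {_c | j = m}) ∧ i.η = ((F.L : ℝ)⁻¹) ^ i.k}) (m : ℕ), HolderAt geo bg GA F.L mem ιCfg ops 1 len CH M i.1 m) ∧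
        (∀ i : {i : ZdIdx 4 F.L // (∀ j, i.Ω j = Set.univ) ∧ (∀ m j, i.Λs m j = {_y | j = m}) ∧ (∀ m j, i.Λb m j = {_c | j = m}) ∧ i.η = ((F.L : ℝ)⁻¹) ^ i.k}, SockLettersRD (𝔸 := Matrix (Fin N) (Fin N) ℂ) F.L BG BR B₀'H B₂' cL i.1.η i.1.k i.1.Ω i.1.Λs) ∧
        (∀ i : {i : ZdIdx 4 F.L // (∀ j, i.Ω j = Set.univ) ∧ (∀ m j, i.Λs m j = {_y | j = m}) ∧ (∀ m j, i.Λb m j = {_c | j = m}) ∧ i.η = ((F.L : ℝ)⁻¹) ^ i.k}, ∀ α₀ : ℝ, 0 < α₀ → α₀ ≤ cL → ∀ U₀ : Site 4 → Fin 4 → (Matrix (Fin N) (Fin N) ℂ)ˣ, (∀ x κ, U₀ x κ ∈ unitaryUnits (Matrix (Fin N) (Fin N) ℂ)) →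
          InAk F.L i.1.k i.1.η α₀ i.1.Ω U₀ →
          ∃ (g Δ : (Site 4 → Matrix (Fin N) (Fin N) ℂ) →ₗ[ℂ] (Site 4 → Matrix (Fin N) (Fin N) ℂ)) (q : (Site 4 → Matrix (Fin N) (Fin N) ℂ) →ₗ[ℂ] (ℕ → Site 4 → Matrix (Fin N) (Fin N) ℂ))
            (qs : (ℕ → Site 4 → Matrix (Fin N) (Fin N) ℂ) →ₗ[ℂ] (Site 4 → Matrix (Fin N) (Fin N) ℂ)) (Aw c : (ℕ → Site 4 → Matrix (Fin N) (Fin N) ℂ) →ₗ[ℂ] (ℕ → Site 4 → Matrix (Fin N) (Fin N) ℂ))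
            (H' : XSpace 4 i.1.k (Matrix (Fin N) (Fin N) ℂ) →ₗ[ℂ] (Site 4 → Matrix (Fin N) (Fin N) ℂ)),
            (∀ x : Site 4 → Matrix (Fin N) (Fin N) ℂ, (∃ C : ℝ, ∀ y, ‖x y‖ ≤ C) → g (Δ x + qs (Aw (q x))) = x) ∧ (∀ φ, qs (c (q (g (g (qs φ))))) = qs φ) ∧
            (∀ (f : Site 4 → Matrix (Fin N) (Fin N) ℂ), ∀ x ∈ i.1.Ω 0, Δ f x = covLap i.1.η U₀ ((i.1.Ω 0).indicator f) x) ∧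
            (∀ (μ : ℕ → Site 4 → Matrix (Fin N) (Fin N) ℂ), ∀ x ∈ i.1.Ω 0, qs μ x = QT F.L i.1.k (i.1.Λs i.1.k) U₀ μ x) ∧
            (∀ (f : Site 4 → Matrix (Fin N) (Fin N) ℂ) (n : ℕ), n ≤ i.1.k → ∀ y ∈ i.1.Λs i.1.k n, q f n y = QprimeIter (zdBlocking 4 F.L) (bgT F.L U₀) n f y) ∧
            (∀ (f : Site 4 → Matrix (Fin N) (Fin N) ℂ) (n : ℕ) (y : Site 4), ¬ (n ≤ i.1.k ∧ y ∈ i.1.Λs i.1.k n) → q f n y = 0) ∧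
            (∀ (X : XSpace 4 i.1.k (Matrix (Fin N) (Fin N) ℂ)) (x : Site 4), ‖H' X x‖ ≤ B₀'H * ‖X‖) ∧
            (∀ n, n ≤ i.1.k → ∀ (X : XSpace 4 i.1.k (Matrix (Fin N) (Fin N) ℂ)), ∀ p ∈ {b : Site 4 × Fin 4 | SideTouches (i.1.Ω n) b.1 b.2},
              wt F.L i.1.η n * ‖covDerivFwd i.1.η U₀ p.2 (H' X) p.1‖ ≤ B₀'H * ‖X‖) ∧
            (∀ X : XSpace 4 i.1.k (Matrix (Fin N) (Fin N) ℂ), Bd2 F.L i.1.η i.1.k i.1.Ω (covLap i.1.η U₀ (H' X)) (B₂' * ‖X‖)) ∧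
            (∀ (Y : XSpace 4 i.1.k (Matrix (Fin N) (Fin N) ℂ)) (n : ℕ) (hn : n ≤ i.1.k) (y : Site 4), y ∈ i.1.Λs i.1.k n →
              QprimeIter (zdBlocking 4 F.L) (bgT F.L U₀) n (H' Y) y = Y (⟨n, Nat.lt_succ_of_le hn⟩, y)) ∧
            (∀ (f : Site 4 → Matrix (Fin N) (Fin N) ℂ) (r : ℝ), 0 ≤ r → Bd2 F.L i.1.η i.1.k i.1.Ω f r →
              (∀ x, ‖g f x‖ ≤ BG * r) ∧ ∀ n, n ≤ i.1.k → ∀ p ∈ {b : Site 4 × Fin 4 | SideTouches (i.1.Ω n) b.1 b.2},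
                wt F.L i.1.η n * ‖covDerivFwd i.1.η U₀ p.2 (g f) p.1‖ ≤ BG * r) ∧
            (∀ (f : Site 4 → Matrix (Fin N) (Fin N) ℂ) (r : ℝ), 0 ≤ r → Bd2 F.L i.1.η i.1.k i.1.Ω f r → Bd2 F.L i.1.η i.1.k i.1.Ω (f - g (qs (c (q (g f))))) (BR * r))))
  (h7 : ∀ F : T4Family, ∃ C ε₀ : ℝ, 0 ≤ C ∧ 0 < ε₀ ∧ ∀ ε : ℝ, 0 < ε → ε ≤ ε₀ →
      LeafH3sup 4 F.L (ne3NperOfRecord₁₁ F 0 0) ε (C * ε) (C * ε) (ne3DomOfRecord₁₁ F N 0 0))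

include hg₃ hD h7

/-! ## The ADMISSIBLE reading of record (node00-def-W1 `ReadingData.ofRecordAdm`), the residual data `ne2`, `ne1` -/

section Admissible

variable
  (S : (F : T4Family) → (θ : Stage13HParams F N) → (k : ℕ) → ClusterTower (F.P k) (MatA N) θ.τ9.M)
  (sp : (F : T4Family) → (θ : Stage13HParams F N) → (k j : ℕ) → (domSys (F.P k) θ.τ9.M j).Dom → Set (CPair (F.P k) (MatA N)))
  (gauge : (F : T4Family) → (θ : Stage13HParams F N) → (k : ℕ) → GaugeField (F.P k) 0 (Node00.SU N) → GaugeField (F.P k) 0 (Node00.SU N) → ℝ)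
  (hg : ∀ (F : T4Family) (θ : Stage13HParams F N) (k : ℕ) (U U' : GaugeField (F.P k) 0 (Node00.SU N)), 0 ≤ gauge F θ k U U')
  (T₀ : (F : T4Family) → (θ : Stage13HParams F N) → (k : ℕ) → GaugeField (F.P (k + 1)) 0 (Node00.SU N) → GaugeField (F.P k) 0 (Node00.SU N))
  (hT₀ : ∀ (F : T4Family) (θ : Stage13HParams F N) (k : ℕ) (U : GaugeField (F.P (k + 1)) 0 (Node00.SU N)),
    (∀ (j : ℕ) (Y : (domSys (F.P (k + 1)) θ.τ9.M j).Dom), ofBackgroundC (ιSU N) U ∈ sp F θ (k + 1) j Y) →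
      ∀ (j : ℕ) (X : (domSys (F.P k) θ.τ9.M j).Dom), ofBackgroundC (ιSU N) (T₀ F θ k U) ∈ sp F θ k j X)
  (li : (F : T4Family) → Stage13HParams F N → LetterInputs)
  (ne2 : (F : T4Family) → Stage13HParams F N → (ℕ → ℝ) → List (ULoop F) → ℕ → NE2Objects₁₁)
  (ne1 : (F : T4Family) → Stage13HParams F N → (ℕ → ℝ) → List (ULoop F) → NE1pCarriers)

/-- ★ **N27 = B5 AT THE STAGE-13 `CoPH` RECORD AT THE CANONICAL HOME OF THE ADMISSIBLE READING — EVERY K4 RATE SLOT IN ITS PRODUCER's DEEPEST LANDED CURRENCY**: N14 ⟸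
END-B uniform leaves on the residual dressed tower at every keyed datum (dag-n14-a `n14At_of_uniformLeaves`), N15 ⟸ the reading equation `hne2` onto `c2BgObjects` (U-E), N16 ⟸
Thm 3.3 + dictionary + letters + N07's leaf (§0, letters chosen by 40ᴮ), N17 eliminated, N18 unfolded, N22 ⟸ N18 (8a″ analytic: (J), (A), eleven numerals), (D4), spine side, N19′
edge ∀ ℓ₃ — (L) §2's canonical theorem with the two K4 faces in its `h14` ∕ `h15` slots.  Every displayed antecedent is a HYPOTHESIS (0∕1 today). [bookkeeping] -/
theorem spine_rec13CCoPH_at_readingAdm₁₃CoPH_of_uniformLeaves_c2Bg_thm33Letters {b aS : ℝ} (hb : 0 < b) (haS : 0 < aS) {c35 : ℝ} (hc35 : 0 < c35) (α β : Fin 4) (p : ℝ)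
    (h14 : ∀ (F : T4Family) (D : Datum F N) (h : IsDatumOfRecord₁₃CCoPH F N D) (g₀ : ℕ → ℝ) (os : List (ULoop F)),
      ∃ U : UniformConstants, U.Λ = (ne1 F h.params g₀ os).Λ ∧ ∀ p K, Nonempty (BookingLeaves U ((ne1 F h.params g₀ os).𝒯.B p K) ((ne1 F h.params g₀ os).𝒯.T p K)))
    (h18 : ∀ (F : T4Family) (D : Datum F N) (h : IsDatumOfRecord₁₃CCoPH F N D) (k : ℕ), N18At (u3OfRecord₁₃ h.params.toStage13Params
      ((ReadingData.ofRecordAdm F h.params.τ9.M N (S F h.params) (sp F h.params) (gauge F h.params) (hg F h.params) (T₀ F h.params) (hT₀ F h.params)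
        (li F h.params)).u3Objects h.params.γ) k))
    -- N22 ⟸ N18 (dag-n22-e module 8a″, analytic sup-letter currency): (J), (A) over ADMISSIBLE run-A fields, eleven numerals — verbatim
    (hjunk : ∀ (F : T4Family) (θ : Stage13HParams F N), θ.Provisos₁₃CoPH F N → θ.Admissible F N →
      ∀ (k : ℕ) (X : Node00.W1.Dom (F.P k) θ.τ9.M), k < X.1 → ∀ (g : ℕ → ℝ) (φ : CPair (F.P k) (MatA N)), functionalC (S F θ k) g φ X = 0)
    (hA : ∀ (F : T4Family) (θ : Stage13HParams F N), θ.Provisos₁₃CoPH F N → θ.Admissible F N → ∀ (k : ℕ),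
      ∀ g ∈ Window θ.γ, ∀ (U : AdmBg F θ.τ9.M N (sp F θ) k) (X : Node00.W1.Dom (F.P k) θ.τ9.M) (i : ℕ), i < X.1 →
        ∃ (Fz : ℂ → ℂ) (Dset : Set ℂ), DifferentiableOn ℂ Fz Dset ∧
          (∀ z ∈ Dset, ‖Fz z‖ ≤ (li F θ).A * (li F θ).μ ^ (X.1 - 1 - i) * Real.exp (-((li F θ).κ * (domSys (F.P k) θ.τ9.M X.1).dj X.2))) ∧
          (∀ t ∈ Ioc (0 : ℝ) θ.γ, closedBall (t : ℂ) (li F θ).r ⊆ Dset) ∧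
          (∀ t ∈ Ioc (0 : ℝ) θ.γ, Fz t = ((functionalC (S F θ k) (Function.update g i t) (ofBackgroundC (ιSU N) U.1) X).re : ℂ)))
    (hnum : ∀ (F : T4Family) (θ : Stage13HParams F N), θ.Provisos₁₃CoPH F N → θ.Admissible F N →
      0 < (li F θ).C₀ ∧ 0 < (li F θ).θ₅ ∧ (li F θ).θ₅ < 1 ∧ 0 ≤ (li F θ).C₅ ∧ 2 * (li F θ).C₅ / (1 - (li F θ).θ₅) ≤ (li F θ).C₀ ∧ 0 < (li F θ).A ∧
        (li F θ).θ₅ ≤ (li F θ).μ ∧ (li F θ).C₀ ≤ 2 * (li F θ).A ∧ 0 < (li F θ).r ∧ 0 < (li F θ).s ∧ (li F θ).s < 1)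
    (hD4 : ∀ (F : T4Family) (D : Datum F N) (h : IsDatumOfRecord₁₃CCoPH F N D) (k : ℕ), ReadOutAt D (u3OfRecord₁₃ h.params.toStage13Params
      ((ReadingData.ofRecordAdm F h.params.τ9.M N (S F h.params) (sp F h.params) (gauge F h.params) (hg F h.params) (T₀ F h.params) (hT₀ F h.params)
        (li F h.params)).u3Objects h.params.γ) k))
    (hx' : S_N27x (fun F D w => IsRecordOfRecord₁₃CCoPH F N D w) (SRec₁₃CoPH cr)) (h20 : S_N20 (SRec₁₃CoPH cr)) (h21 : S_N21 (SRec₁₃CoPH cr))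
    (h19 : ∀ (ℓ₃ : T4Family → NE3Letters₁₁) (F : T4Family) (θ : Stage13HParams F N) (hP : θ.Provisos₁₃CoPH F N), θ.Admissible F N → ∀ (g₀ : ℕ → ℝ) (os : List (ULoop F))
      (h : IsDatumOfRecord₁₃CCoPH F N (datumOfRecord₁₃CoPH F N θ hP)) (k : ℕ),
      RatesAt (datumOfRecord₁₃CoPH F N θ hP) (rateCarriersOfRecord₁₃CoPH (readingOfRecord₁₃CoPH
        (fun F θ => ReadingData.ofRecordAdm F θ.τ9.M N (S F θ) (sp F θ) (gauge F θ) (hg F θ) (T₀ F θ) (hT₀ F θ) (li F θ)) ℓ₃ ne2 ne1)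
          F h.params h.provisos g₀ os k) → letI := (cr F θ hP g₀ os).dec
        ∃ δ : ℕ → ℝ, NE7.Core (cr F θ hP g₀ os).l₀ (cr F θ hP g₀ os).vol (cr F θ hP g₀ os).T (cr F θ hP g₀ os).Bad
          (fun K t τ => (cr F θ hP g₀ os).A K t τ - (cr F θ hP g₀ os).shA K t τ) (fun K t τ => (cr F θ hP g₀ os).B K t τ - (cr F θ hP g₀ os).shB K t τ) δ ∧
          Summable δ)
    (hne2 : ∀ (F : T4Family) (θ : Stage13HParams F N), θ.Provisos₁₃CoPH F N → θ.Admissible F N → ∀ (g₀ : ℕ → ℝ) (os : List (ULoop F)) (k : ℕ),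
      ne2 F θ g₀ os k = haveI := neZero_blockFactor F; c2BgObjects 3 F.hL b aS α β c35 p) :
    Spine (N := N) fun F D w => IsRecordOfRecord₁₃CCoPH F N D w := by
  obtain ⟨ℓ₃, h16, -⟩ := exists_letters_s_N16_readingOfRecord₁₃CoPH_of_thm33Letters_allTorus
    (w1 := fun F θ => ReadingData.ofRecordAdm F θ.τ9.M N (S F θ) (sp F θ) (gauge F θ) (hg F θ) (T₀ F θ) (hT₀ F θ) (li F θ)) (ne2 := ne2) (ne1 := ne1) hg₃ hD h7
  have h18' : S_N18 (RRec₁₃CoPH (readingOfRecord₁₃CoPH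
      (fun F θ => ReadingData.ofRecordAdm F θ.τ9.M N (S F θ) (sp F θ) (gauge F θ) (hg F θ) (T₀ F θ) (hT₀ F θ) (li F θ)) ℓ₃ ne2 ne1)) :=
    (s_N18_readingOfRecord₁₃CoPH_iff _ ℓ₃ ne2 ne1).mpr h18
  exact spine_rec13CCoPH_at_readingOfRecord₁₃CoPH cr _ ℓ₃ ne2 ne1
    ((s_N14_readingOfRecord₁₃CoPH_iff _ ℓ₃ ne2 ne1).mpr fun F D h g₀ os => n14At_of_uniformLeaves _ (h14 F D h g₀ os))
    (s_N15_readingOfRecord₁₃CoPH_of_c2Bg_family _ ℓ₃ ne2 ne1 hb haS hc35 α β p hne2) h16 h18'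
    (s_N22_readingOfRecord₁₃CoPH_ofRecordAdm_of_s_N18_analytic S sp gauge hg T₀ hT₀ li ℓ₃ ne2 ne1 h18' hjunk hA hnum)
    ((s_D4_readingOfRecord₁₃CoPH_iff _ ℓ₃ ne2 ne1).mpr hD4) hx' h20 h21 (h19 ℓ₃)

/-- ★★ **N27 = B5 AT THE REGIME RECORD CLASS, ANY `Rg`, AT THE ADMISSIBLE READING — EVERY K4 RATE SLOT IN ITS PRODUCER's DEEPEST LANDED CURRENCY**: N14 ⟸ END-B uniform
leaves at every guarded admissible tuple (dag-n14-c `s_N14_rRec₁₃CoPHOn_of_uniformLeaves`), N15 ⟸ `hne2` onto `c2BgObjects` (U-E, guarded), N16 ⟸ §0 (40ᴮ), N17 eliminated,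
N18 in CLOSED FORM at θ on W1's admissible tables, N22 ⟸ N18 (8a″ STRIP: (J), twelve numerals, STRIP-(1.18)), (D4), K5 side, N19′ edge ∀ ℓ₃ — (L) §2's regime theorem with the
two K4 faces in its slots.  At `Rg := Node00.unityNondeg₁₃H N` RR-2's CN class; at `N = 2`, `Rg :=` the item's guard, THE ITEM (leaf C).  Every displayed antecedent is a
HYPOTHESIS (0∕1 today). [bookkeeping] -/
theorem spine_rec13CCoPHOn_at_readingAdm₁₃CoPH_of_uniformLeaves_c2Bg_thm33Letters (Rg : (F : T4Family) → Stage13HParams F N → Prop) {b aS : ℝ} (hb : 0 < b) (haS : 0 < aS) {c35 : ℝ} (hc35 : 0 < c35) (α β : Fin 4) (p : ℝ)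
    (h14 : ∀ (F : T4Family) (θ : Stage13HParams F N), θ.Provisos₁₃CoPH F N → Rg F θ → θ.Admissible F N → ∀ (g₀ : ℕ → ℝ) (os : List (ULoop F)),
      ∃ U : UniformConstants, U.Λ = (ne1 F θ g₀ os).Λ ∧ ∀ p K, Nonempty (BookingLeaves U ((ne1 F θ g₀ os).𝒯.B p K) ((ne1 F θ g₀ os).𝒯.T p K)))
    (h18 : ∀ (F : T4Family) (θ : Stage13HParams F N), θ.Provisos₁₃CoPH F N → Rg F θ → θ.Admissible F N → ∀ (k : ℕ) (b : ℝ), 0 < b → b ≤ θ.γ →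
      ∀ g ∈ Window θ.γ,
        ∀ (U : {U : GaugeField (F.P (k + 1)) 0 (Node00.SU N) //
            ∀ (j : ℕ) (Y : (domSys (F.P (k + 1)) θ.τ9.M j).Dom), ofBackgroundC (ιSU N) U ∈ sp F θ (k + 1) j Y})
          (X : Node00.W1.Dom (F.P k) θ.τ9.M),
        |(functionalC (S F θ k) g (ofBackgroundC (ιSU N) (T₀ F θ k U.1)) X).re -
            (functionalC (S F θ (k + 1)) (prependCoupling b g) (ofBackgroundC (ιSU N) U.1) (pairOfRecord F θ.τ9.M k X)).re| ≤
          (li F θ).C₅ * (li F θ).θ₅ ^ X.1 * Real.exp (-((li F θ).κ * (domSys (F.P k) θ.τ9.M X.1).dj X.2)))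
    -- N22 ⟸ N18 (dag-n22-e module 8a″, STRIP currency on the reading's OWN table, NO readings clause): (J), twelve numerals, STRIP-(1.18) — verbatim
    (hjunk : ∀ (F : T4Family) (θ : Stage13HParams F N), θ.Provisos₁₃CoPH F N → Rg F θ → θ.Admissible F N →
      ∀ (k : ℕ) (X : Node00.W1.Dom (F.P k) θ.τ9.M), k < X.1 → ∀ (g : ℕ → ℝ) (φ : CPair (F.P k) (MatA N)), functionalC (S F θ k) g φ X = 0)
    (hnum : ∀ (F : T4Family) (θ : Stage13HParams F N), θ.Provisos₁₃CoPH F N → Rg F θ → θ.Admissible F N →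
      0 < (li F θ).C₀ ∧ 0 < (li F θ).θ₅ ∧ (li F θ).θ₅ < 1 ∧ 0 ≤ (li F θ).C₅ ∧ 2 * (li F θ).C₅ / (1 - (li F θ).θ₅) ≤ (li F θ).C₀ ∧ 0 < (li F θ).A ∧
        (li F θ).θ₅ ≤ (li F θ).μ ∧ (li F θ).C₀ ≤ 2 * (li F θ).A ∧ 0 < (li F θ).r ∧ 0 < (li F θ).s ∧ (li F θ).s < 1 ∧ 1 ≤ (li F θ).μ)
    (hstrip : ∀ (F : T4Family) (θ : Stage13HParams F N), θ.Provisos₁₃CoPH F N → Rg F θ → θ.Admissible F N → ∀ (k : ℕ),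
      ∀ (j : ℕ) (g : ℕ → ℝ), g ∈ Window θ.γ → ∀ (i : ℕ) (Y : (domSys (F.P k) θ.τ9.M j).Dom) (ψ : CPair (F.P k) (MatA N)), ψ ∈ sp F θ k j Y →
        ∃ (Ec : ℂ → ℂ) (O : Set ℂ), IsOpen O ∧ (∀ t ∈ Ioc (0 : ℝ) θ.γ, closedBall (t : ℂ) (li F θ).r ⊆ O) ∧ DifferentiableOn ℂ Ec O ∧
          (∀ z ∈ O, ‖Ec z‖ ≤ (li F θ).A * Real.exp (-((li F θ).κ * torusTreeLen Y.1))) ∧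
          (∀ t ∈ Ioc (0 : ℝ) θ.γ, Ec t = termC (S F θ k) j Y (Function.update g i t) ψ))
    (hD4 : ∀ (F : T4Family) (θ : Stage13HParams F N) (hP : θ.Provisos₁₃CoPH F N), Rg F θ → θ.Admissible F N → ∀ k : ℕ,
      ReadOutAt (datumOfRecord₁₃CoPH F N θ hP) (u3OfRecord₁₃ θ.toStage13Params
        ((ReadingData.ofRecordAdm F θ.τ9.M N (S F θ) (sp F θ) (gauge F θ) (hg F θ) (T₀ F θ) (hT₀ F θ) (li F θ)).u3Objects θ.γ) k))
    (h20 : S_N20 (SRec₁₃CoPHOn cr Rg)) (h21 : S_N21 (SRec₁₃CoPHOn cr Rg))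
    (hx : ∀ (F : T4Family) (θ : Stage13HParams F N) (hP : θ.Provisos₁₃CoPH F N), Rg F θ → θ.Admissible F N →
      B16.EndStatementBPrinted (datumOfRecord₁₃CoPH F N θ hP).C → DagBinding.EndpointExistence (datumOfRecord₁₃CoPH F N θ hP).C.toB12 →
        ForSmallCouplings (datumOfRecord₁₃CoPH F N θ hP) fun g₀ => ∀ os : List (ULoop F),
          0 < (cr F θ hP g₀ os).l₀ ∧ 0 < (cr F θ hP g₀ os).vol ∧
          (∀ (K : ℕ) (t : ℝ), |t| ≤ (cr F θ hP g₀ os).l₀ →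
            T4GenFunBounds.schemeZ ((datumOfRecord₁₃CoPH F N θ hP).scheme g₀) os ((cr F θ hP g₀ os).K₀ + K) t =
              ∑ τ ∈ (cr F θ hP g₀ os).T K, (cr F θ hP g₀ os).A K t τ) ∧
          (∀ (K : ℕ) (t : ℝ), |t| ≤ (cr F θ hP g₀ os).l₀ →
            T4GenFunBounds.schemeZ ((datumOfRecord₁₃CoPH F N θ hP).scheme g₀) os ((cr F θ hP g₀ os).K₀ + K + 1) t =
              ∑ τ ∈ (cr F θ hP g₀ os).T K, (cr F θ hP g₀ os).B K t τ))
    (h19 : ∀ (ℓ₃ : T4Family → NE3Letters₁₁) (F : T4Family) (θ : Stage13HParams F N) (hP : θ.Provisos₁₃CoPH F N), Rg F θ → θ.Admissible F N → ∀ (g₀ : ℕ → ℝ) (os : List (ULoop F)),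
      (∀ k : ℕ, RatesAt (datumOfRecord₁₃CoPH F N θ hP) (rateCarriersOfRecord₁₃CoPH (readingOfRecord₁₃CoPH
        (fun F θ => ReadingData.ofRecordAdm F θ.τ9.M N (S F θ) (sp F θ) (gauge F θ) (hg F θ) (T₀ F θ) (hT₀ F θ) (li F θ)) ℓ₃ ne2 ne1) F θ hP g₀ os k)) →
        letI := (cr F θ hP g₀ os).dec
        ∃ δ : ℕ → ℝ, NE7.Core (cr F θ hP g₀ os).l₀ (cr F θ hP g₀ os).vol (cr F θ hP g₀ os).T (cr F θ hP g₀ os).Bad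
          (fun K t τ => (cr F θ hP g₀ os).A K t τ - (cr F θ hP g₀ os).shA K t τ) (fun K t τ => (cr F θ hP g₀ os).B K t τ - (cr F θ hP g₀ os).shB K t τ) δ ∧
          Summable δ)
    (hne2 : ∀ (F : T4Family) (θ : Stage13HParams F N), θ.Provisos₁₃CoPH F N → θ.Admissible F N → ∀ (g₀ : ℕ → ℝ) (os : List (ULoop F)) (k : ℕ),
      ne2 F θ g₀ os k = haveI := neZero_blockFactor F; c2BgObjects 3 F.hL b aS α β c35 p) :
    Spine (N := N) fun F D w => Node00.IsRecordOfRecord₁₃CCoPHOn F N Rg D w := by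
  obtain ⟨ℓ₃, h16, -⟩ := exists_letters_s_N16_readingOfRecord₁₃CoPHOn_of_thm33Letters_allTorus (Rg := Rg)
    (w1 := fun F θ => ReadingData.ofRecordAdm F θ.τ9.M N (S F θ) (sp F θ) (gauge F θ) (hg F θ) (T₀ F θ) (hT₀ F θ) (li F θ)) (ne2 := ne2) (ne1 := ne1) hg₃ hD h7
  have h18' : S_N18 (RRec₁₃CoPHOn (readingOfRecord₁₃CoPH
      (fun F θ => ReadingData.ofRecordAdm F θ.τ9.M N (S F θ) (sp F θ) (gauge F θ) (hg F θ) (T₀ F θ) (hT₀ F θ) (li F θ)) ℓ₃ ne2 ne1) Rg) :=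
    (s_N18_readingOfRecord₁₃CoPHOn_iff _ ℓ₃ ne2 ne1 Rg).mpr fun F θ hP hRg hθ k =>
      (n18At_u3OfRecord₁₃_readingAdm_iff θ.toStage13Params k (S F θ) (sp F θ) (gauge F θ) (hg F θ) (T₀ F θ) (hT₀ F θ) (li F θ)).mpr (h18 F θ hP hRg hθ k)
  exact spine_rec13CCoPHOn_at_readingOfRecord₁₃CoPH cr _ ℓ₃ ne2 ne1 Rg
    (s_N14_rRec₁₃CoPHOn_of_uniformLeaves _ Rg fun F θ hP hRg hθ g₀ os => h14 F θ hP hRg hθ g₀ os)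
    (s_N15_readingOfRecord₁₃CoPHOn_of_c2Bg_family _ ℓ₃ ne2 ne1 hb haS hc35 α β p hne2 Rg) h16
    h18' (s_N22_readingOfRecord₁₃CoPHOn_ofRecordAdm_of_s_N18_stripBound S sp gauge hg T₀ hT₀ li ℓ₃ ne2 ne1 Rg h18' hjunk hnum hstrip)
    ((s_D4_rRec₁₃CoPHOn_iff _ Rg).mpr fun F θ hP hRg hθ _ _ k => hD4 F θ hP hRg hθ k) h20 h21 hx (h19 ℓ₃)

end Admissible

end Summit.QuantumFields.YangMills.Theorems.BalabanUVNodesN27SpineRecord
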